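import Literature.InformationTheory.QuantumCodes.RotatedSurfaceCode
import Literature.InformationTheory.QuantumCodes.CSSEquivalence
import HarnessLib

/-!
# The quarter turn of the rotated surface code: for ODD `L`, the `X ↔ Z` exchange of `RSC(L)` is `RSC(L)` re-indexed

Topic `Literature/InformationTheory/QuantumCodes` (venture QEC, rung Q5, row 09; qec-type-09 gen 6, item «09.RSCSAWZ»). All
PROVED, kernel axioms, no named fact. type-08's `RotatedSurfaceCode.lean` puts the qubits of `RSC(L)` on the `L × L` grid,
the `X`-faces at `(a', b) ∈ Fin (L+1) × Fin (L-1)` (valid when `a' + b` is odd, meeting rows `{a'-1, a'}` and columns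
`{b, b+1}`) and the `Z`-faces at `(a, b') ∈ Fin (L-1) × Fin (L+1)` (valid when `a + b'` is even, rows `{a, a+1}`, columns
`{b'-1, b'}`). The quarter turn of the grid, `(i, j) ↦ (j, L-1-i)`, carries rows to columns and the row pair `{a, a+1}` to
the column pair `{L-2-a, L-1-a}`; on face labels it is the same recipe `(a, b) ↦ (b, rev a)` (`qturn`). It changes the colour
`a' + b` by `L` modulo `2`, so:

* `HZ_apply_eq_HX_qturn`, `HX_apply_eq_HZ_qturn` — for ODD `L`, `H_Z[z, q] = H_X[qturn z, qturn q]` and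
  `H_X[x, q] = H_Z[qturn x, qturn q]` (all faces, valid or not);
* ★ `code_swap_eq_reindex` — for ODD `L`, `(RSC(L)).swap = (RSC(L)).reindex …` along the quarter turn: the `H_Z` sector of
  an odd-distance rotated surface code is its `H_X` sector relabelled (so every `H_X`-sector decoder / threshold statement
  transports, `CSSEquivalenceDecoders.lean`).

For EVEN `L` no isometry of the grid exchanges the colours (`RSC(2) = [[4,1,2]]` has the single `X`-check `XXXX` but the
`Z`-checks `ZZII`, `IIZZ`); nothing is claimed there.

## References

* [TomitaSvore2014] Y. Tomita, K. M. Svore, *Low-distance surface codes under realistic quantum noise*, PRA 90 (2014)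
  062320, §2.2 (the rotated layout; Surface-17).
* [BombinMartinDelgado2007Optimal] H. Bombin, M. A. Martin-Delgado, PRA 76 (2007) 012305, §IV (the rotated planar code and
  the square grid it lives on).
* [LinPryadko2024] H.-K. Lin, L. P. Pryadko, *Quantum two-block group algebra codes*, PRA 109 (2024) 022407, §4.2 Thm 6
  (permutation-equivalent CSS codes).
-/

namespace Literature.InformationTheory.QuantumCodes

namespace RotatedSurface

open Matrix

variable {L : ℕ}

/-! ### The quarter turn -/

/-- **The quarter turn** of an `m × n` label grid: `(a, b) ↦ (b, m-1-a)` (on qubits, `m = n = L`: the rotation of the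
`L × L` grid by `90°`; on face labels: the induced relabelling). (definition)
[cite: BombinMartinDelgado2007Optimal, §IV (the rotated planar code, n = d²)] -/
def qturn (m n : ℕ) : Fin m × Fin n ≃ Fin n × Fin m :=
  (Equiv.prodComm (Fin m) (Fin n)).trans (Equiv.prodCongr (Equiv.refl (Fin n)) Fin.revPerm)

/-- `qturn (a, b) = (b, rev a)`. [cite: BombinMartinDelgado2007Optimal, §IV] -/
@[simp] theorem qturn_apply {m n : ℕ} (a : Fin m) (b : Fin n) : qturn m n (a, b) = (b, Fin.rev a) := rfl

/-! ### Odd `L`: the two check matrices are each other's quarter turn -/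

/-- **`H_Z[z, q] = H_X[qturn z, qturn q]` for odd `L`**: the `Z`-face `(a, b')` (rows `{a, a+1}`, columns `{b'-1, b'}`,
colour `a + b'` even) turns into the `X`-face `(b', L-2-a)` (rows `{b'-1, b'}`, columns `{L-2-a, L-1-a}`, colour
`b' + L - 2 - a` odd). [cite: TomitaSvore2014, §2.2 (X and Z stabilizers of the rotated layout)]
[cite: BombinMartinDelgado2007Optimal, §IV] -/
theorem HZ_apply_eq_HX_qturn (hL : Odd L) (z : Fin (L - 1) × Fin (L + 1)) (q : Fin L × Fin L) :
    HZ L z q = HX L (qturn (L - 1) (L + 1) z) (qturn L L q) := by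
  obtain ⟨k, rfl⟩ := hL
  obtain ⟨⟨a, ha⟩, ⟨b, hb⟩⟩ := z
  obtain ⟨⟨i, hi⟩, ⟨j, hj⟩⟩ := q
  simp only [HX, HZ, vx, vz, rx, cx, rz, cz, qturn_apply, Fin.val_rev, Fin.val_mk]
  split_ifs <;> first | rfl | (exfalso; omega)

/-- **`H_X[x, q] = H_Z[qturn x, qturn q]` for odd `L`**: the `X`-face `(a', b)` turns into the `Z`-face `(b, L-a')`.
[cite: TomitaSvore2014, §2.2] [cite: BombinMartinDelgado2007Optimal, §IV] -/
theorem HX_apply_eq_HZ_qturn (hL : Odd L) (x : Fin (L + 1) × Fin (L - 1)) (q : Fin L × Fin L) :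
    HX L x q = HZ L (qturn (L + 1) (L - 1) x) (qturn L L q) := by
  obtain ⟨k, rfl⟩ := hL
  obtain ⟨⟨a, ha⟩, ⟨b, hb⟩⟩ := x
  obtain ⟨⟨i, hi⟩, ⟨j, hj⟩⟩ := q
  simp only [HX, HZ, vx, vz, rx, cx, rz, cz, qturn_apply, Fin.val_rev, Fin.val_mk]
  split_ifs <;> first | rfl | (exfalso; omega)

/-- Matrix form: `H_Z = H_X ∘ (qturn × qturn)` for odd `L`. [cite: LinPryadko2024, §4.2 Thm 6 (permutation equivalence)] -/
theorem HZ_eq_submatrix_HX (hL : Odd L) : HZ L = (HX L).submatrix (qturn (L - 1) (L + 1)) (qturn L L) := by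
  ext z q
  rw [Matrix.submatrix_apply]
  exact HZ_apply_eq_HX_qturn hL z q

/-- Matrix form: `H_X = H_Z ∘ (qturn × qturn)` for odd `L`. [cite: LinPryadko2024, §4.2 Thm 6 (permutation equivalence)] -/
theorem HX_eq_submatrix_HZ (hL : Odd L) : HX L = (HZ L).submatrix (qturn (L + 1) (L - 1)) (qturn L L) := by
  ext x q
  rw [Matrix.submatrix_apply]
  exact HX_apply_eq_HZ_qturn hL x q

/-- ★ **For odd `L`, the `X ↔ Z` exchange of `RSC(L)` is `RSC(L)` re-indexed by the quarter turn**: the `H_Z` sector of an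
odd-distance rotated surface code is its `H_X` sector relabelled. [cite: LinPryadko2024, §4.2 Thm 6 (permutation-equivalent
CSS codes)] [cite: BombinMartinDelgado2007Optimal, §IV] -/
theorem code_swap_eq_reindex (hL : Odd L) :
    (code L).swap = (code L).reindex (qturn (L - 1) (L + 1)).symm (qturn (L + 1) (L - 1)).symm (qturn L L).symm :=
  CSSCode.eq_reindex_of_submatrix (C := code L) (C' := (code L).swap) (HZ_eq_submatrix_HX hL) (HX_eq_submatrix_HZ hL)

/-- Conversely `RSC(L)` is its exchange re-indexed (odd `L`). [cite: LinPryadko2024, §4.2 Thm 6] -/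
theorem code_eq_swap_reindex (hL : Odd L) :
    code L = (code L).swap.reindex (qturn (L + 1) (L - 1)).symm (qturn (L - 1) (L + 1)).symm (qturn L L).symm :=
  CSSCode.eq_reindex_of_submatrix (C := (code L).swap) (C' := code L) (HX_eq_submatrix_HZ hL) (HZ_eq_submatrix_HX hL)

end RotatedSurface

end Literature.InformationTheory.QuantumCodes
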